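import Literature.Algebra.Homology.LefschetzNumber
import Mathlib.Algebra.Category.ModuleCat.ChangeOfRings
import Mathlib.LinearAlgebra.Trace
import HarnessLib

/-!
# The Hopf trace formula under base change: complexes of free `R`-modules read in a field `K`

Layer `Literature/Algebra/Homology` (pure linear algebra over Mathlib; proved theorems only, 0 definitions, 0 named facts, no instances,
no notation). Hatcher's Thm. 2C.3 is printed for a bounded complex `C` of finitely generated FREE abelian groups:
`Σ (−1)ⁿ tr(fₙ : Cₙ → Cₙ) = Σ (−1)ⁿ tr(f_* : Hₙ(C) → Hₙ(C))` (traces on `Hₙ ∕ torsion`). Row `LefschetzNumber` gives the right-hand side over a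
FIELD as the Lefschetz number `Λ`. This file is the base-change bridge: for a ring map `f : R →+* K` to a field, a homological complex `C`
of finitely generated free `R`-modules (any shape `c` with `EulerCharSigns`, finitely many non-zero terms) and an endomorphism `φ`, with
`C_K := K ⊗_R C` (Mathlib's `ModuleCat.extendScalars f` applied degreewise) and `φ_K := K ⊗_R φ`:

* `trace_extendScalars_map` — `tr_K(K ⊗_R l) = f(tr_R l)` (Mathlib `LinearMap.trace_baseChange`, BY NAME);
* `moduleFinite_extendScalars_obj`, `finrank_extendScalars_obj`, `finrankSupport_extendScalars_subset` — finiteness transport;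
* **`map_finsum_χ_smul_trace_f : f (Σᶠ i, χ(i) • tr_R(φᵢ)) = lefschetzNumber φ_K`** (row `LefschetzNumber`'s
  `lefschetzNumber_eq_finsum_χ_smul_trace_f` on `C_K`, BY NAME) — the chain-level super-trace over `R` IS the Lefschetz number over `K`;
* `lefschetzNumber_map_mem_range` — integrality: `lefschetzNumber φ_K ∈ f.range`;
* `map_finsum_χ_smul_finrank` (`φ = 𝟙`: `f (Σᶠ i, χ(i) • rank_R Cᵢ) = Λ(𝟙)`) and `map_finsum_χ_smul_finrank_eq_homologyEulerChar`
  (`= χ_H(C_K)`, row `LefschetzNumber`'s `lefschetzNumber_id`).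

No flatness of `f` and no `PreservesHomology` instance is needed (homology is only taken over `K`). The functor `mapHomologicalComplex`
requires `[(ModuleCat.extendScalars f).Additive]`, which Mathlib does not register; it is carried as an instance HYPOTHESIS, dischargeable
BY NAME by the tree's theorem `Literature.Algebra.Homology.additive_extendScalars` (row `FlatQuasiIsoBaseChange`); no instance is declared
here. The identification of `tr_K H(φ_K)` with traces on `Hₙ(C) ∕ torsion` (Hatcher's left-hand reading over `ℤ`) is NOT in this file.
Library only (cell `pub-hodge-ring2`, count-neutral); proves nothing about any crux, route or conjecture.

## References

* A. Hatcher, *Algebraic Topology* (2002), §2.C, Thm. 2C.3 (Hopf trace formula over `ℤ`). [HatcherAT2002]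
* E. H. Spanier, *Algebraic Topology* (1981), Ch. 4 §7, Thm. 6. [Spanier1981]
-/

open CategoryTheory CategoryTheory.Limits

universe v u₁ u₂ w

namespace Literature.Algebra.Homology.HopfTrace

variable {R : Type u₁} [CommRing R] {K : Type u₂} [Field K] (f : R →+* K)

/-! ### One module -/

/-- **`tr_K(K ⊗_R l) = f(tr_R l)`** for an endomorphism `l` of a finitely generated free `R`-module (Mathlib's `LinearMap.trace_baseChange`
read on `ModuleCat.extendScalars f`). [cite: HatcherAT2002, Thm. 2C.3] -/
theorem trace_extendScalars_map (M : ModuleCat.{v} R) [Module.Free R M] [Module.Finite R M] (l : M ⟶ M) :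
    LinearMap.trace K ((ModuleCat.extendScalars f).obj M) ((ModuleCat.extendScalars f).map l).hom = f (LinearMap.trace R M l.hom) := by
  letI : Algebra R K := ((algebraMap K K).comp f).toAlgebra
  exact LinearMap.trace_baseChange (A := K) l.hom

/-- `K ⊗_R M` is finite-dimensional when `M` is finitely generated. [cite: HatcherAT2002, Thm. 2C.3] -/
theorem moduleFinite_extendScalars_obj (M : ModuleCat.{v} R) [Module.Finite R M] :
    Module.Finite K ((ModuleCat.extendScalars f).obj M) := by
  letI : Algebra R K := ((algebraMap K K).comp f).toAlgebra
  exact Module.Finite.base_change R K M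

/-- `dim_K (K ⊗_R M) = rank_R M` for `M` finitely generated free (`R` is non-trivial since it maps to a field).
[cite: HatcherAT2002, Thm. 2C.3] -/
theorem finrank_extendScalars_obj (M : ModuleCat.{v} R) [Module.Free R M] [Module.Finite R M] :
    Module.finrank K ((ModuleCat.extendScalars f).obj M) = Module.finrank R M := by
  letI : Algebra R K := ((algebraMap K K).comp f).toAlgebra
  haveI : Nontrivial R := f.domain_nontrivial
  exact Module.finrank_baseChange

/-- An endomorphism of a free module of rank `0` over a non-trivial ring has trace `0`. [cite: HatcherAT2002, Thm. 2C.3] -/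
theorem trace_eq_zero_of_finrank_eq_zero [Nontrivial R] (M : ModuleCat.{v} R) [Module.Free R M] [Module.Finite R M]
    (h0 : Module.finrank R M = 0) (l : M →ₗ[R] M) : LinearMap.trace R M l = 0 := by
  classical
  haveI : IsEmpty (Module.Free.ChooseBasisIndex R M) :=
    Fintype.card_eq_zero_iff.1 ((Module.finrank_eq_card_chooseBasisIndex R M).symm.trans h0)
  rw [LinearMap.trace_eq_matrix_trace R (Module.Free.chooseBasis R M), Matrix.trace_eq_zero_of_isEmpty]

/-! ### A complex -/

variable {ι : Type w} {c : ComplexShape ι} [(ModuleCat.extendScalars.{u₁, u₂, v} f).Additive]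
  (C : HomologicalComplex (ModuleCat.{v} R) c) (φ : C ⟶ C)

/-- The rank support of `K ⊗_R C` lies in that of `C` (free finitely generated terms). [cite: HatcherAT2002, Thm. 2C.3] -/
theorem finrankSupport_extendScalars_subset [∀ i, Module.Free R (C.X i)] [∀ i, Module.Finite R (C.X i)] :
    GradedObject.finrankSupport (((ModuleCat.extendScalars f).mapHomologicalComplex c).obj C).X ⊆ GradedObject.finrankSupport C.X := by
  intro i hi
  have h : Module.finrank K ((ModuleCat.extendScalars f).obj (C.X i)) = Module.finrank R (C.X i) := finrank_extendScalars_obj f (C.X i)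
  simp only [GradedObject.finrankSupport, Function.mem_support, ne_eq] at hi ⊢
  exact fun h0 => hi (h.trans h0)

/-- **The chain-level super-trace over `R` is the Lefschetz number over `K`**: for a homological complex `C` of finitely generated free
`R`-modules with finitely many non-zero terms and an endomorphism `φ`, `f (Σᶠ i, χ(i) • tr_R(φᵢ)) = Λ(K ⊗_R φ)` — Hatcher's Thm. 2C.3 with
its right-hand side read in `K` (row `LefschetzNumber`'s `lefschetzNumber_eq_finsum_χ_smul_trace_f` on `K ⊗_R C`).
[cite: HatcherAT2002, Thm. 2C.3] [cite: Spanier1981, Ch. 4 §7 Thm. 6] -/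
theorem map_finsum_χ_smul_trace_f [c.EulerCharSigns] [∀ i, Module.Free R (C.X i)] [∀ i, Module.Finite R (C.X i)]
    (hC : (GradedObject.finrankSupport C.X).Finite) :
    f (∑ᶠ i, (c.χ i : ℤ) • LinearMap.trace R (C.X i) (φ.f i).hom) =
      Lefschetz.lefschetzNumber (((ModuleCat.extendScalars f).mapHomologicalComplex c).map φ) := by
  haveI : ∀ i, Module.Finite K ((((ModuleCat.extendScalars f).mapHomologicalComplex c).obj C).X i) := fun i =>
    moduleFinite_extendScalars_obj f (C.X i)
  rw [Lefschetz.lefschetzNumber_eq_finsum_χ_smul_trace_f _ (hC.subset (finrankSupport_extendScalars_subset f C))]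
  haveI : Nontrivial R := f.domain_nontrivial
  have hs : (fun i => (c.χ i : ℤ) • LinearMap.trace R (C.X i) (φ.f i).hom).HasFiniteSupport := by
    refine hC.subset fun i hi => ?_
    simp only [GradedObject.finrankSupport, Function.mem_support, ne_eq] at hi ⊢
    exact fun h0 => hi (by rw [trace_eq_zero_of_finrank_eq_zero (C.X i) h0, smul_zero])
  rw [map_finsum f hs]
  refine finsum_congr fun i => ?_
  rw [map_zsmul]
  exact congrArg _ (trace_extendScalars_map f (C.X i) (φ.f i)).symm

/-- **Integrality**: the Lefschetz number of `K ⊗_R φ` lies in the image of `R` (for `R = ℤ`, `K = ℚ`: `Λ ∈ ℤ`).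
[cite: HatcherAT2002, Thm. 2C.3] -/
theorem lefschetzNumber_map_mem_range [c.EulerCharSigns] [∀ i, Module.Free R (C.X i)] [∀ i, Module.Finite R (C.X i)]
    (hC : (GradedObject.finrankSupport C.X).Finite) :
    Lefschetz.lefschetzNumber (((ModuleCat.extendScalars f).mapHomologicalComplex c).map φ) ∈ f.range :=
  ⟨_, map_finsum_χ_smul_trace_f f C φ hC⟩

/-- **The rank form** (`φ = 𝟙`): `f (Σᶠ i, χ(i) • rank_R Cᵢ) = Λ(𝟙_{K ⊗_R C})`, the Euler characteristic of `K ⊗_R C` computed on chains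
(row `LefschetzNumber`'s `lefschetzNumber_id` turns the right-hand side into `χ_H(K ⊗_R C)`). [cite: HatcherAT2002, Thm. 2C.3] -/
theorem map_finsum_χ_smul_finrank [c.EulerCharSigns] [∀ i, Module.Free R (C.X i)] [∀ i, Module.Finite R (C.X i)]
    (hC : (GradedObject.finrankSupport C.X).Finite) :
    f (∑ᶠ i, (c.χ i : ℤ) • (Module.finrank R (C.X i) : R)) =
      Lefschetz.lefschetzNumber (𝟙 (((ModuleCat.extendScalars f).mapHomologicalComplex c).obj C)) := by
  rw [← CategoryTheory.Functor.map_id, ← map_finsum_χ_smul_trace_f f C (𝟙 C) hC]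
  congr 1
  refine finsum_congr fun i => ?_
  rw [HomologicalComplex.id_f, ModuleCat.hom_id, LinearMap.trace_id]

/-- **Euler characteristic across base change**: `f (Σᶠ i, χ(i) • rank_R Cᵢ) = χ_H(K ⊗_R C)` (cast to `K`) — the chain-rank count over `R`
is the homological Euler characteristic over `K` (row `LefschetzNumber`'s `lefschetzNumber_id` on `K ⊗_R C`).
[cite: HatcherAT2002, Thm. 2C.3] [cite: Spanier1981, Ch. 4 §7 Thm. 6] -/
theorem map_finsum_χ_smul_finrank_eq_homologyEulerChar [c.EulerCharSigns] [∀ i, Module.Free R (C.X i)] [∀ i, Module.Finite R (C.X i)]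
    (hC : (GradedObject.finrankSupport C.X).Finite) :
    f (∑ᶠ i, (c.χ i : ℤ) • (Module.finrank R (C.X i) : R)) =
      ((((ModuleCat.extendScalars f).mapHomologicalComplex c).obj C).homologyEulerChar : K) := by
  haveI : ∀ i, Module.Finite K ((((ModuleCat.extendScalars f).mapHomologicalComplex c).obj C).X i) := fun i =>
    moduleFinite_extendScalars_obj f (C.X i)
  haveI : ∀ i, Module.Finite K ((((ModuleCat.extendScalars f).mapHomologicalComplex c).obj C).homology i) := fun i =>
    moduleFinite_homology _ i
  rw [map_finsum_χ_smul_finrank f C hC, Lefschetz.lefschetzNumber_id]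
  refine (hC.subset (finrankSupport_extendScalars_subset f C)).subset fun i hi => ?_
  simp only [GradedObject.finrankSupport, Function.mem_support, ne_eq] at hi ⊢
  intro h0
  have h := EulerPoincare.finrank_homology_le (((ModuleCat.extendScalars f).mapHomologicalComplex c).obj C) i
  rw [h0, Nat.le_zero] at h
  exact hi h

end Literature.Algebra.Homology.HopfTrace
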